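import Literature.MathematicalPhysics.QuantumLattice.HubbardTTPrimeGrandCanonicalPressureZeeman
import Literature.MathematicalPhysics.QuantumLattice.SectorPartitionFnCut
import Literature.MathematicalPhysics.QuantumLattice.HubbardTTPrimeThermalPressureZeemanBrackets
import Literature.MathematicalPhysics.QuantumLattice.HubbardTTPrimeOpenBoxGrandCanonicalPressureCap
import Literature.MathematicalPhysics.QuantumLattice.HubbardOpenBoxMixedSectorWitness
import Literature.MathematicalPhysics.QuantumLattice.PeierlsOrthonormalFamily
import HarnessLib

/-!
# The GRAND-CANONICAL cap from sector ground-energy floors — `Re Tr e^{−β(A − μN − hM)} ≤ Σ_{a,b} e^{β(μ(a+b)+h(a−b))} C(|Λ|,a) C(|Λ|,b) e^{−βq_{a+b}}` —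
# and the one-band `T > 0` pressure window of the `t–t′` Hubbard model from GROUND-STATE-TYPE cluster certificates alone

Topic `Literature/MathematicalPhysics/QuantumLattice` (family `hubbard`; crew hubbard-fast S2 «T > 0 certificate family», seat hubbard-box-p1). Grand-canonical
twin of `PartitionFnSectorFloorCap` (`μ = h = 0`; independent of it). The two-sided cluster window on the grand-canonical pressure of the square-lattice `t–t′` Hubbard model
(`HubbardTTPrimeOpenBoxGrandCanonicalPressureCap.gcPressureTT'Zeeman_mem_Icc_of_openBox_certificates`: `z_lo ≤ log Re Ξ^open_ℓ(t,t′)`,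
`log Re Ξ^open_ℓ(κt, κ²t′) ≤ z_hi` ⇒ `z_lo/ℓ² ≤ P(β;t,t′,U;μ,h) ≤ z_hi/ℓ²`) needs two certified numbers on grand-canonical cluster partition functions. This
file produces both from what the kernel cluster devices already emit:

* §1 **`partitionFn_sub_sub_re_le_sum_of_sector_floors`**: for `A` Hermitian and sector-preserving on the fermion Fock space over `Λ`, `β ≥ 0`, reals
  `μ, h` and floors `q_k ≤ E₀(A,k)` (`k ≤ 2|Λ|`):
  `Re Z_β(A − μN − hM) ≤ Σ_{a ≤ |Λ|} Σ_{b ≤ |Λ|} e^{β(μ(a+b) + h(a−b))}·C(|Λ|,a)·C(|Λ|,b)·e^{−β q_{a+b}}` (sector decomposition with a Zeeman field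
  `partitionFn_sub_sub_re_eq_sum` + the one-sector bound of `PartitionFnSectorFloorCap`); logarithmic and certified-number forms.
* §2 **the one-band readings**: `z_hi` for the BOOSTED open cluster `hubbardOpenBoxTT' ℓ ℓ (κt) (κ²t′) U` from its sector floors
  (`log_partitionFn_hubbardOpenBoxTT'_gc_le_of_sector_floors`; the hypothesis is the conclusion shape of `groundEnergy_ge_of_kCerts₃`), hence
  **`sq_mul_gcPressureTT'Zeeman_le_of_sector_floors`**: `ℓ²·P(β;t,t′,U;μ,h) ≤ log Σ_{a,b ≤ ℓ²} e^{β(μ(a+b)+h(a−b))} C(ℓ²,a) C(ℓ²,b) e^{−β q_{a+b}}`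
  (`β, U ≥ 0`, `ℓ ≥ 2`); and `z_lo` for the PHYSICAL open cluster from an orthonormal family of cluster vectors with certified Rayleigh quotients of
  `hubbardOpenBoxTT' ℓ ℓ t t′ U − μN − hM` (`le_sq_mul_gcPressureTT'Zeeman_of_rayleighFamily`, Peierls): **the whole `T > 0` window from ED-type data**.

Everything is PROVED (0 sorry); no definition, no named fact, no number. HONEST SCOPE: the cap is the crude «T = 0 floors + full sector entropies»
bound — tight as `β → ∞`, loose by `≤ 2ℓ² log 2/ℓ²` per site at high temperature; the floor is as good as the trial family.

## Tree / Mathlib search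

REUSED: `partitionFn_sub_sub_re_eq_sum`, `isHermitian_sub_sub` (`HubbardTTPrimeGrandCanonicalPressureZeeman`); the one-sector argument of
`PartitionFnSectorFloorCap` (`sectorEigenvalue/vector`, `re_rayleigh_sectorEigenvector`, `groundEnergy_le_re_expect`, `card_subtype_spinConfig_le_choose_mul_choose`) inlined; `sq_mul_gcPressureTT'Zeeman_le_log_partitionFn_openBox_boost`, `log_partitionFn_openBox_gc_le_sq_mul_gcPressure`
(`HubbardTTPrimeOpenBoxGrandCanonicalPressureCap/Exact`); `hubbardOpenBoxTT'(_isHermitian)` (`HubbardNNNHoppingOpenClusters`), `preservesSectors_hubbardOpenBoxTT'` (`HubbardOpenBoxMixedSectorWitness`); `Matrix.IsHermitian.log_sum_exp_neg_mul_rayleigh_le` (`PeierlsOrthonormalFamily`);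
`card_rectSites`, `partitionFn_re_pos`. `lean search 'sub_sub_re_le|gcPressure.*sector_floors'` (2026-08-28): nothing.

## References

* D. Ruelle, *Statistical Mechanics: Rigorous Results* (1969), §2.5–2.6, §3.4. [cite: Ruelle1969, §3.4]
* R. B. Israel, *Convexity in the Theory of Lattice Gases* (1979), Lemma II.3.1. [cite: Israel1979, Lemma II.3.1]
* R. Valentí, J. Stolze, P. J. Hirschfeld, Phys. Rev. B 43 (1991) 13743, §II. [cite: ValentiStolzeHirschfeld1991, §II]
-/

noncomputable section

open scoped ComplexOrder BigOperators
open Finset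

namespace Literature.MathematicalPhysics.QuantumLattice

open Matrix HubbardWave0 LiebThm1 ThermodynamicLimit

variable {Λ : Type*} [LinearOrder Λ] [Fintype Λ]

/-! ### §1. The grand-canonical cap from sector floors -/

/-- **THE GRAND-CANONICAL CAP FROM SECTOR GROUND-ENERGY FLOORS.** For `A` Hermitian and sector-preserving, `β ≥ 0`, reals `μ, h` and floors
`q_k ≤ E₀(A,k)` (`k ≤ 2|Λ|`): `Re Z_β(A − μN − hM) ≤ Σ_{a,b ≤ |Λ|} e^{β(μ(a+b)+h(a−b))}·C(|Λ|,a)·C(|Λ|,b)·e^{−β q_{a+b}}`.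
[cite: Ruelle1969, §3.4] [cite: Israel1979, Lemma II.3.1] -/
theorem partitionFn_sub_sub_re_le_sum_of_sector_floors {A : Matrix (Finset (Orb Λ)) (Finset (Orb Λ)) ℂ} (hA : A.IsHermitian)
    (hP : PreservesSectors A) {β : ℝ} (hβ : 0 ≤ β) (μ hz : ℝ) {q : ℕ → ℝ} (hq : ∀ k ≤ 2 * Fintype.card Λ, q k ≤ groundEnergy A k) :
    (partitionFn β (A - (μ : ℂ) • totalNumber - (hz : ℂ) • spinImbalance)).re ≤
      ∑ a ∈ Finset.range (Fintype.card Λ + 1), ∑ b ∈ Finset.range (Fintype.card Λ + 1),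
        Real.exp (β * μ * (a + b) + β * hz * (a - b)) *
          (((Fintype.card Λ).choose a * (Fintype.card Λ).choose b : ℕ) * Real.exp (-(β * q (a + b)))) := by
  -- one sector: every eigenvalue of `A|_{(a,b)}` is `≥ E₀(A, a+b) ≥ q_{a+b}` (its zero-extended eigenvector is a unit `(a+b)`-particle vector),
  -- so `Re Z_β(A|_{(a,b)}) ≤ |sector|·e^{−β q_{a+b}} ≤ C(|Λ|,a)C(|Λ|,b)·e^{−β q_{a+b}}` (as in `PartitionFnSectorFloorCap`)
  have hsec : ∀ a b : ℕ, a + b ≤ 2 * Fintype.card Λ →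
      (partitionFn β (spinSectorHamiltonian a b A)).re ≤
        ((Fintype.card Λ).choose a * (Fintype.card Λ).choose b : ℕ) * Real.exp (-(β * q (a + b))) := by
    intro a b hab
    have hinv : ∀ s s' : Finset (Orb Λ), ¬ spinConfig a b s → spinConfig a b s' → A s s' = 0 :=
      fun s s' hs hs' => apply_eq_zero_of_preservesSectors hP a b s s' hs hs'
    have hev : ∀ c : Subtype (spinConfig (Λ := Λ) a b), q (a + b) ≤ sectorEigenvalue (spinConfig a b) A hA c := by
      intro c
      have hsupp : IsInSector a b (sectorEigenvector (spinConfig a b) A hA c) :=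
        (isInSector_iff_support a b _).2 fun s hs => sectorEigenvector_apply_of_not_mem (spinConfig a b) A hA c hs
      have h := LiebThm1.groundEnergy_le_re_expect A hsupp.isNParticle (star_sectorEigenvector_dotProduct_self (spinConfig a b) A hA c)
      rw [expect, re_rayleigh_sectorEigenvector (spinConfig a b) hA hinv c] at h
      exact (hq (a + b) hab).trans h
    rw [partitionFn_spinSectorHamiltonian_re a b hA β]
    calc ∑ c, Real.exp (-(β * sectorEigenvalue (spinConfig a b) A hA c))
        ≤ ∑ _c : Subtype (spinConfig (Λ := Λ) a b), Real.exp (-(β * q (a + b))) :=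
          Finset.sum_le_sum fun c _ => Real.exp_le_exp.2 (by nlinarith [hev c])
      _ = (Fintype.card (Subtype (spinConfig (Λ := Λ) a b)) : ℝ) * Real.exp (-(β * q (a + b))) := by
          rw [Finset.sum_const, Finset.card_univ, nsmul_eq_mul]
      _ ≤ _ := by
          refine mul_le_mul_of_nonneg_right ?_ (Real.exp_pos _).le
          exact_mod_cast card_subtype_spinConfig_le_choose_mul_choose (Λ := Λ) a b
  rw [partitionFn_sub_sub_re_eq_sum hP β μ hz]
  refine Finset.sum_le_sum fun a ha => Finset.sum_le_sum fun b hb => ?_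
  have hak : a ≤ Fintype.card Λ := Nat.lt_succ_iff.1 (Finset.mem_range.1 ha)
  have hbk : b ≤ Fintype.card Λ := Nat.lt_succ_iff.1 (Finset.mem_range.1 hb)
  exact mul_le_mul_of_nonneg_left (hsec a b (by omega)) (Real.exp_pos _).le

/-- **Logarithmic form.** [cite: Ruelle1969, §3.4] -/
theorem log_partitionFn_sub_sub_le_of_sector_floors {A : Matrix (Finset (Orb Λ)) (Finset (Orb Λ)) ℂ} (hA : A.IsHermitian)
    (hP : PreservesSectors A) {β : ℝ} (hβ : 0 ≤ β) (μ hz : ℝ) {q : ℕ → ℝ} (hq : ∀ k ≤ 2 * Fintype.card Λ, q k ≤ groundEnergy A k) :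
    Real.log (partitionFn β (A - (μ : ℂ) • totalNumber - (hz : ℂ) • spinImbalance)).re ≤
      Real.log (∑ a ∈ Finset.range (Fintype.card Λ + 1), ∑ b ∈ Finset.range (Fintype.card Λ + 1),
        Real.exp (β * μ * (a + b) + β * hz * (a - b)) *
          (((Fintype.card Λ).choose a * (Fintype.card Λ).choose b : ℕ) * Real.exp (-(β * q (a + b))))) := by
  haveI : Nonempty (Finset (Orb Λ)) := ⟨∅⟩
  exact Real.log_le_log (partitionFn_re_pos (isHermitian_sub_sub hA μ hz) β)
    (partitionFn_sub_sub_re_le_sum_of_sector_floors hA hP hβ μ hz hq)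

/-- **Certified-number form**: if the explicit sum is `≤ e^u` then `log Re Z_β(A − μN − hM) ≤ u`. [cite: Ruelle1969, §3.4] -/
theorem log_partitionFn_sub_sub_le_of_sector_floors_of_sum_le {A : Matrix (Finset (Orb Λ)) (Finset (Orb Λ)) ℂ} (hA : A.IsHermitian)
    (hP : PreservesSectors A) {β : ℝ} (hβ : 0 ≤ β) (μ hz : ℝ) {q : ℕ → ℝ} (hq : ∀ k ≤ 2 * Fintype.card Λ, q k ≤ groundEnergy A k) {u : ℝ}
    (hu : ∑ a ∈ Finset.range (Fintype.card Λ + 1), ∑ b ∈ Finset.range (Fintype.card Λ + 1),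
        Real.exp (β * μ * (a + b) + β * hz * (a - b)) *
          (((Fintype.card Λ).choose a * (Fintype.card Λ).choose b : ℕ) * Real.exp (-(β * q (a + b)))) ≤ Real.exp u) :
    Real.log (partitionFn β (A - (μ : ℂ) • totalNumber - (hz : ℂ) • spinImbalance)).re ≤ u := by
  haveI : Nonempty (Finset (Orb Λ)) := ⟨∅⟩
  have hpos := partitionFn_re_pos (isHermitian_sub_sub hA μ hz) β
  calc Real.log (partitionFn β (A - (μ : ℂ) • totalNumber - (hz : ℂ) • spinImbalance)).re ≤ Real.log (Real.exp u) :=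
        Real.log_le_log hpos ((partitionFn_sub_sub_re_le_sum_of_sector_floors hA hP hβ μ hz hq).trans hu)
    _ = u := Real.log_exp u

/-! ### §2. The one-band `t–t′` readings: both halves of the cluster window from ground-state-type data -/

namespace ThermodynamicLimit

/-- **`z_hi` FROM SECTOR FLOORS**: for the open `a × b` `t–t′` cluster, `β ≥ 0` and floors `q_k ≤ E₀(hubbardOpenBoxTT' a b t t' U, k)` (`k ≤ 2ab`, the
conclusion shape of `groundEnergy_ge_of_kCerts₃`):
`log Re Z_β(hubbardOpenBoxTT' a b t t' U − μN − hM) ≤ log Σ_{p,p' ≤ ab} e^{β(μ(p+p')+h(p−p'))} C(ab,p) C(ab,p') e^{−β q_{p+p'}}`. [cite: Ruelle1969, §3.4] -/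
theorem log_partitionFn_hubbardOpenBoxTT'_gc_le_of_sector_floors (a b : ℕ) (t t' U : ℝ) {β : ℝ} (hβ : 0 ≤ β) (μ hz : ℝ) {q : ℕ → ℝ}
    (hq : ∀ k ≤ 2 * (a * b), q k ≤ groundEnergy (hubbardOpenBoxTT' a b t t' U) k) :
    Real.log (partitionFn β (hubbardOpenBoxTT' a b t t' U - (μ : ℂ) • totalNumber - (hz : ℂ) • spinImbalance)).re ≤
      Real.log (∑ p ∈ Finset.range (a * b + 1), ∑ p' ∈ Finset.range (a * b + 1),
        Real.exp (β * μ * (p + p') + β * hz * (p - p')) * ((((a * b).choose p * (a * b).choose p' : ℕ) : ℝ) * Real.exp (-(β * q (p + p'))))) := by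
  have hcard : Fintype.card (Fin a ×ₗ Fin b) = a * b := card_rectSites a b
  have h := log_partitionFn_sub_sub_le_of_sector_floors (hubbardOpenBoxTT'_isHermitian a b t t' U) (preservesSectors_hubbardOpenBoxTT' a b t t' U)
    hβ μ hz (q := q) (by rw [hcard]; exact hq)
  rw [hcard] at h
  exact h

/-- **THE `T > 0` PRESSURE CAP OF THE `t–t′` HUBBARD MODEL FROM GROUND-STATE-TYPE CERTIFICATES** (`β, U ≥ 0`, `ℓ ≥ 2`, `κ = ℓ/(ℓ−1)`): sector floors
`q_k ≤ E₀(hubbardOpenBoxTT' ℓ ℓ (κt) (κ²t′) U, k)` of the BOOSTED open cluster give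
`ℓ²·P(β;t,t′,U;μ,h) ≤ log Σ_{p,p' ≤ ℓ²} e^{β(μ(p+p')+h(p−p'))}·C(ℓ²,p)·C(ℓ²,p')·e^{−β q_{p+p'}}`. [cite: Israel1979, Lemma II.3.1] [cite: ValentiStolzeHirschfeld1991, §II] -/
theorem sq_mul_gcPressureTT'Zeeman_le_of_sector_floors {β : ℝ} (hβ : 0 ≤ β) (t t' : ℝ) {U : ℝ} (hU : 0 ≤ U) (μ hz : ℝ) {ℓ : ℕ} (hℓ : 2 ≤ ℓ)
    {q : ℕ → ℝ} (hq : ∀ k ≤ 2 * (ℓ * ℓ), q k ≤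
      groundEnergy (hubbardOpenBoxTT' ℓ ℓ ((ℓ : ℝ) / ((ℓ : ℝ) - 1) * t) (((ℓ : ℝ) / ((ℓ : ℝ) - 1)) ^ 2 * t') U) k) :
    (ℓ : ℝ) ^ 2 * gcPressureTT'Zeeman β t t' U μ hz ≤
      Real.log (∑ p ∈ Finset.range (ℓ * ℓ + 1), ∑ p' ∈ Finset.range (ℓ * ℓ + 1),
        Real.exp (β * μ * (p + p') + β * hz * (p - p')) * ((((ℓ * ℓ).choose p * (ℓ * ℓ).choose p' : ℕ) : ℝ) * Real.exp (-(β * q (p + p'))))) :=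
  (sq_mul_gcPressureTT'Zeeman_le_log_partitionFn_openBox_boost hβ t t' hU μ hz hℓ).trans
    (log_partitionFn_hubbardOpenBoxTT'_gc_le_of_sector_floors ℓ ℓ _ _ U hβ μ hz hq)

/-- **THE `T > 0` PRESSURE FLOOR OF THE `t–t′` HUBBARD MODEL FROM CLUSTER VECTORS** (`β, U ≥ 0`, `ℓ ≥ 1`): a nonempty orthonormal family `(φ_i)` of
vectors of the open `ℓ × ℓ` cluster's Fock space with certified `Re⟨φ_i, (hubbardOpenBoxTT' ℓ ℓ t t′ U − μN − hM) φ_i⟩ ≤ e_i` gives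
`log Σ_i e^{−β e_i} ≤ ℓ²·P(β;t,t′,U;μ,h)`. [cite: Ruelle1969, §2.5–2.6] [cite: Israel1979, Lemma II.3.1] -/
theorem le_sq_mul_gcPressureTT'Zeeman_of_rayleighFamily {β : ℝ} (hβ : 0 ≤ β) (t t' : ℝ) {U : ℝ} (hU : 0 ≤ U) (μ hz : ℝ) {ℓ : ℕ} (hℓ : 1 ≤ ℓ)
    {ι : Type*} [Fintype ι] [DecidableEq ι] [Nonempty ι] {φ : ι → Fock (Orb (Fin ℓ ×ₗ Fin ℓ))}
    (hφ : ∀ i j, star (φ i) ⬝ᵥ φ j = if i = j then 1 else 0) {e : ι → ℝ}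
    (he : ∀ i, (star (φ i) ⬝ᵥ ((hubbardOpenBoxTT' ℓ ℓ t t' U - (μ : ℂ) • totalNumber - (hz : ℂ) • spinImbalance) *ᵥ φ i)).re ≤ e i) :
    Real.log (∑ i, Real.exp (-(β * e i))) ≤ (ℓ : ℝ) ^ 2 * gcPressureTT'Zeeman β t t' U μ hz := by
  have hH := isHermitian_sub_sub (hubbardOpenBoxTT'_isHermitian ℓ ℓ t t' U) μ hz
  have h1 := hH.log_sum_exp_neg_mul_rayleigh_le β hφ
  have h2 := log_partitionFn_openBox_gc_le_sq_mul_gcPressure hβ t t' hU μ hz hℓ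
  have hpos : 0 < ∑ i, Real.exp (-(β * e i)) := Finset.sum_pos (fun i _ => Real.exp_pos _) Finset.univ_nonempty
  have hmono : ∑ i, Real.exp (-(β * e i)) ≤
      ∑ i, Real.exp (-(β * (star (φ i) ⬝ᵥ ((hubbardOpenBoxTT' ℓ ℓ t t' U - (μ : ℂ) • totalNumber - (hz : ℂ) • spinImbalance) *ᵥ φ i)).re)) :=
    Finset.sum_le_sum fun i _ => Real.exp_le_exp.2 (by nlinarith [he i])
  exact ((Real.log_le_log hpos hmono).trans h1).trans h2

/-- **THE WINDOW FROM GROUND-STATE-TYPE DATA, certificate form** (`β, U ≥ 0`, `ℓ ≥ 2`): a Rayleigh family of the physical cluster with bounds `e_i` and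
sector floors `q_k` of the boosted cluster give
`ℓ⁻²·log Σ_i e^{−βe_i} ≤ P(β;t,t′,U;μ,h) ≤ ℓ⁻²·log Σ_{p,p'} e^{β(μ(p+p')+h(p−p'))} C(ℓ²,p) C(ℓ²,p') e^{−βq_{p+p'}}`.
[cite: Ruelle1969, §3.4] [cite: Israel1979, Lemma II.3.1] [cite: ValentiStolzeHirschfeld1991, §II] -/
theorem gcPressureTT'Zeeman_mem_Icc_of_groundStateData {β : ℝ} (hβ : 0 ≤ β) (t t' : ℝ) {U : ℝ} (hU : 0 ≤ U) (μ hz : ℝ) {ℓ : ℕ} (hℓ : 2 ≤ ℓ)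
    {ι : Type*} [Fintype ι] [DecidableEq ι] [Nonempty ι] {φ : ι → Fock (Orb (Fin ℓ ×ₗ Fin ℓ))}
    (hφ : ∀ i j, star (φ i) ⬝ᵥ φ j = if i = j then 1 else 0) {e : ι → ℝ}
    (he : ∀ i, (star (φ i) ⬝ᵥ ((hubbardOpenBoxTT' ℓ ℓ t t' U - (μ : ℂ) • totalNumber - (hz : ℂ) • spinImbalance) *ᵥ φ i)).re ≤ e i)
    {q : ℕ → ℝ} (hq : ∀ k ≤ 2 * (ℓ * ℓ), q k ≤
      groundEnergy (hubbardOpenBoxTT' ℓ ℓ ((ℓ : ℝ) / ((ℓ : ℝ) - 1) * t) (((ℓ : ℝ) / ((ℓ : ℝ) - 1)) ^ 2 * t') U) k) :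
    gcPressureTT'Zeeman β t t' U μ hz ∈ Set.Icc
      (Real.log (∑ i, Real.exp (-(β * e i))) / (ℓ : ℝ) ^ 2)
      (Real.log (∑ p ∈ Finset.range (ℓ * ℓ + 1), ∑ p' ∈ Finset.range (ℓ * ℓ + 1),
        Real.exp (β * μ * (p + p') + β * hz * (p - p')) * ((((ℓ * ℓ).choose p * (ℓ * ℓ).choose p' : ℕ) : ℝ) * Real.exp (-(β * q (p + p'))))) /
          (ℓ : ℝ) ^ 2) := by
  have hℓpos : (0 : ℝ) < ℓ := by exact_mod_cast (show 0 < ℓ by omega)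
  have hℓ2 : (0 : ℝ) < (ℓ : ℝ) ^ 2 := by positivity
  constructor
  · rw [div_le_iff₀ hℓ2, mul_comm]
    exact le_sq_mul_gcPressureTT'Zeeman_of_rayleighFamily hβ t t' hU μ hz (by omega) hφ he
  · rw [le_div_iff₀ hℓ2, mul_comm]
    exact sq_mul_gcPressureTT'Zeeman_le_of_sector_floors hβ t t' hU μ hz hℓ hq

end ThermodynamicLimit

end Literature.MathematicalPhysics.QuantumLattice

end
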